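import Summits.QuantumFields.YangMills.Theorems.UnitScaleTiltProp7SectET3LandauOpRowsT3
import Summits.QuantumFields.YangMills.Theorems.UnitScaleTiltProp7H46TwOfN06
import HarnessLib

/-!
# Route `UnitScaleTilt`, crux «MinimiserStabilityRegPr» (stmt-QuantumFields-19200, stub EX `stub_existenceMinimalOrbit`), route (α) — **JUNCTION (46)₂ AT THE FAMILY LEVEL:
# THE DISPLAYED ROW `h46₂` OF THE EX DISPLAY OF RECORD S9 (✓`Prop7StubEXOfChartPiecesTwS9`, p660931) VERBATIM — (137)–(140) for the letter of record `H46` — FROM THE BACKGROUND-LEVEL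
# OPERATOR ROWS OF RECORD {`h137`, `hOp139`, `hOp349`} (★px5 g2 ✓`Prop7SectET3LandauOpRows.hΔH_of_opRows`), THE N06 ROW `hN06`, THE (115)-NORM ROW `norm_H₁` AND THE (WF) WINDOWS**,
# with the explicit constant `BH₂ L := c137 L + k139 L · B₀ L + k349 L · B₀ L + (28 + 4) · α L · B₀ L` (the door by which a successor display S10 := S9 with `h46₂ ↦ {h137, hOp139, hOp349}` is a by-name composition).

Cell `ym3-torus`, width seat `ym-ust-19200-w2` (gen 6; EX knit lineage ∕ EX letter namer).  THEOREMS ONLY (0 `def`, 0 `sorry`); `--supports stmt-QuantumFields-19200 --as helper`, count-neutral.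
YM₃ on T³ is a ladder rung (R3), not the Clay problem; nothing here claims the stub, the crux, d = 4 or the mass gap.

THE PRINT.  [Balaban1985Variational] (137)–(140) pp. 298–299: *«D*DH, Δ_{U₀}H are bounded operators in the norm |·|₍₋₃₎ … by (138), the fact that G′RD* is a bounded operator in |·|₍₁₎ …
and the fact that DPD* is a bounded operator»* for `H = GQ*(QGQ*)⁻¹` ([Balaban1985BackgroundPropagators] (3.126) p. 420).  THE ROWS (member texts = ★px5 g2's ✓`hΔH_of_opRows` binders VERBATIM,
here quantified over the family `∀ L, 1 < L → ∀ (i : Idx L) U₀, RegPr … (α L) U₀ → …` with the weights `c₀ L, cB L, a L i` of the letters of record): `h137` — the (137) block letter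
`‖toL2⁻¹(Q_k†((QGQ*)⁻¹(toL2B Y)) − Q_k†(a•toL2B Y))‖ ≤ c137·‖Y‖` (generic `Y`); `hOp139` — «`G′RD*` bounded in |·|₍₁₎» + (138): `‖toL2⁻¹((DG′R_SD*)†(Δ^η(toL2 X)))‖ ≤ k139·s` for Landau `X`
(`R_S(D*(toL2 X)) = 0`) of sup size `s`; `hOp349` — «`DPD*` bounded», `P = 1 − R_S` ((3.49)): `‖toL2⁻¹(D(D*(toL2 X)) − D(R_S(D*(toL2 X))))‖ ≤ k349·s`.  INHABITABILITY (★★OWNER RULING g27-№9 (3)):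
all three are BACKGROUND-LEVEL operator sentences over the landed Hilbert letters `DL2 DstarL2 RS GprimeT DeltaEta Qk KinvT toL2 toL2B` at `U₀ ∈ 𝔘_k(α)`; trivially true at `X = 0`∕`Y = 0`;
finite-dimensional at fixed `(F, K)`; content = the `K`-uniformity of `c137 k139 k349` = [Balaban1985BackgroundPropagators] Thm 3.3∕(3.49)∕(3.25) ∕ [Balaban1985Variational] (137)–(139) —
the N06 storey (desk I-06); no `H`∕`Y`∕solution letter in them, so no junk value is read.

WHAT IS PROVED (ns `…Theorems.Prop7H46TwoOfOpRowsFamily`).  ★★★`h46₂_of_opRows_family` — S9's binder `h46₂` quantifier for quantifier, with `BH₂ L := c137 L + k139 L * B₀ L + k349 L * B₀ L +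
(28 + 4) * α L * B₀ L`, from `hα hef hWe hWε hB₀ hN06 norm_H₁` and the three row families: at each member ✓`hΔH_of_opRows` with `h46 :=` the (46)₀ clause of ✓`Prop7H46TwOfN06.h46tw_letter_of_N06_normH`
(read pointwise by `norm_le_pi_norm`), `hp hq := hN06`, `ε₀ := α L`.  ★`hBH₂_of_nonneg` — the display's `hBH₂ : 0 ≤ BH₂ L` from `0 ≤ c137 L, k139 L, k349 L` (displayed numerics; at a member
they FOLLOW from the rows, ✓`k_nonneg_of_op137∕139∕349`, but the family level has no member in hand).  HONEST SCOPE: a by-name composition; the three rows, `hN06` and `norm_H₁` stay DISPLAYED.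

References: T. Bałaban, CMP 102 (1985) 277–309 [Balaban1985Variational] ((137)–(140) pp.298–299, (19) p.281, (46) p.285); CMP 99 (1985) 389–434 [Balaban1985BackgroundPropagators]
(Thm 3.11 p.418, (3.25) p.394, (3.49) p.399, (3.126) p.420).
-/

set_option autoImplicit false

noncomputable section

open scoped InnerProductSpace Matrix.Norms.L2Operator BigOperators

namespace Summit.QuantumFields.YangMills.Theorems.Prop7H46TwoOfOpRowsFamily

open Literature.MathematicalPhysics.QuantumFieldTheory.Balaban1983to89
open Literature.MathematicalPhysics.QuantumFieldTheory.Balaban1983to89.T3ContinuumYM3Torus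
open Literature.MathematicalPhysics.QuantumFieldTheory.Balaban1983to89.T3Thm1Carrier (Idx)
open Literature.MathematicalPhysics.QuantumFieldTheory.Balaban1983to89.T3PrintedRegularMinimiser (RegPr)
open T3SectALandauChart (eta bgUnits covCodiffCurlT covLapFormT)
open B9SectCLatticeCarrier (Bond)
open B9Eq311L2Pairing (WL2)
open B11Eq103H1Complex (BondL2K)
open Summit.QuantumFields.YangMills.Theorems.Prop7SectET3Transport (periodsT3)
open Summit.QuantumFields.YangMills.Theorems.Prop7SectET3HilbertLetters (W₂ toL2 toL2B DL2 DstarL2)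
open Summit.QuantumFields.YangMills.Theorems.Prop7SectET3GaugeProjector (RS)
open Summit.QuantumFields.YangMills.Theorems.Prop7SectET3WilsonHessian (DeltaEta)
open Summit.QuantumFields.YangMills.Theorems.Prop7SectET3CurvedPropagators (Qk PosOnto GT KinvT H1f)
open Summit.QuantumFields.YangMills.Theorems.Prop7SectET3DeltaPi (PosPrime GprimeT DeltaPiSlot H46)
open Summit.QuantumFields.YangMills.Theorems.Prop7H46TwOfN06 (h46tw_letter_of_N06_normH)
open Summit.QuantumFields.YangMills.Theorems.Prop7SectET3LandauOpRows (hΔH_of_opRows)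

variable [hFL : ∀ F : T3Family, Fact (0 < (F.L : ℝ))] [hFη : ∀ (F : T3Family) (k : ℕ), Fact (0 < ((F.L : ℝ)⁻¹) ^ k)]
variable {α : ℕ → ℝ} {c₀ cB : ℕ → ℝ} [hc₀ : ∀ L : ℕ, Fact (0 < c₀ L)] [hcB : ∀ L : ℕ, Fact (0 < cB L)] {a : ∀ L : ℕ, Idx L → ℝ}
  {ef B₀ c137 k139 k349 : ℕ → ℝ}

omit hFL hFη hc₀ hcB in
/-- ★ The display's `hBH₂ : 0 ≤ BH₂ L` for `BH₂ L := c137 L + k139 L·B₀ L + k349 L·B₀ L + 32·α L·B₀ L` from the displayed numerics `0 ≤ c137 L, k139 L, k349 L` (and `0 < α L, B₀ L`). [folklore] -/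
theorem hBH₂_of_nonneg (hα : ∀ L, 1 < L → 0 < α L) (hB₀ : ∀ L, 1 < L → 0 < B₀ L)
    (hk : ∀ L, 1 < L → 0 ≤ c137 L ∧ 0 ≤ k139 L ∧ 0 ≤ k349 L) :
    ∀ L : ℕ, 1 < L → 0 ≤ c137 L + k139 L * B₀ L + k349 L * B₀ L + (28 + 4) * α L * B₀ L := by
  intro L hL
  obtain ⟨h1, h2, h3⟩ := hk L hL
  have hα' := (hα L hL).le
  have hB' := (hB₀ L hL).le
  positivity

/-- ★★★ **S9's ROW `h46₂` — (137)–(140) FOR THE LETTER OF RECORD `H46`, FAMILY LEVEL, VERBATIM — FROM THE THREE OPERATOR ROWS OF RECORD, `hN06`, `norm_H₁` AND THE (WF) WINDOWS**, with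
`BH₂ L := c137 L + k139 L * B₀ L + k349 L * B₀ L + (28 + 4) * α L * B₀ L` (✓`hΔH_of_opRows` at each member; (46)₀ from ✓`h46tw_letter_of_N06_normH`).
[cite: Balaban1985Variational, (137)–(140) pp.298–299, (46) p.285, (19) p.281; Balaban1985BackgroundPropagators, Thm 3.11 p.418, (3.25) p.394, (3.49) p.399, (3.126) p.420, (3.133) p.422] -/
theorem h46₂_of_opRows_family (hα : ∀ L, 1 < L → 0 < α L) (hef : ∀ L, 1 < L → 0 < ef L)
    (hWe : ∀ L : ℕ, 1 < L → 10 ^ 9 * (L : ℝ) ^ 2 * ef L ≤ 1) (hWε : ∀ L : ℕ, 1 < L → 10 ^ 12 * (L : ℝ) ^ 3 * α L ≤ 1) (hB₀ : ∀ L, 1 < L → 0 < B₀ L)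
    (hN06 : ∀ (L : ℕ), 1 < L → ∀ (i : Idx L) (U₀ : GaugeField (i.1.1.P i.1.2.2) 0 (Matrix.specialUnitaryGroup (Fin 2) ℂ)), RegPr i.1.1 i.1.2.1 i.1.2.2 (α L) U₀ →
      PosOnto i.1.1 i.1.2.1 i.1.2.2 i.2.2.le (c₀ L) (cB L) (a L i) (DeltaPiSlot i.1.1 i.1.2.1 i.1.2.2 i.2.2.le (c₀ L) (cB L) (a L i)) U₀ ∧
      PosPrime i.1.1 i.1.2.1 i.1.2.2 i.2.2.le (c₀ L) (cB L) (a L i) U₀)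
    (norm_H₁ : ∀ (L : ℕ), 1 < L → ∀ (i : Idx L) (ρ : ℝ) (U₀ : GaugeField (i.1.1.P i.1.2.2) 0 (Matrix.specialUnitaryGroup (Fin 2) ℂ)),
      RegPr i.1.1 i.1.2.1 i.1.2.2 ρ U₀ → ρ ≤ α L →
        ∀ b, ‖H1f i.1.1 i.1.2.1 i.1.2.2 i.2.2.le (c₀ L) (cB L) (a L i) (DeltaPiSlot i.1.1 i.1.2.1 i.1.2.2 i.2.2.le (c₀ L) (cB L) (a L i)) U₀ b‖ ≤ B₀ L * ‖b‖)
    (h137 : ∀ (L : ℕ), 1 < L → ∀ (i : Idx L) (U₀ : GaugeField (i.1.1.P i.1.2.2) 0 (Matrix.specialUnitaryGroup (Fin 2) ℂ)), RegPr i.1.1 i.1.2.1 i.1.2.2 (α L) U₀ →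
      ∀ (Y : PBond (i.1.1.P i.1.2.1) 0 → Matrix (Fin 2) (Fin 2) ℂ) (b : PBond (i.1.1.P i.1.2.2) 0),
        ‖(toL2 i.1.1 i.1.2.2 (c₀ L)).symm (LinearMap.adjoint (Qk i.1.1 i.1.2.1 i.1.2.2 i.2.2.le (c₀ L) (cB L) U₀) (KinvT i.1.1 i.1.2.1 i.1.2.2 i.2.2.le (c₀ L) (cB L) (a L i) (DeltaPiSlot i.1.1 i.1.2.1 i.1.2.2 i.2.2.le (c₀ L) (cB L) (a L i)) U₀ (toL2B i.1.1 i.1.2.1 (cB L) Y))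
            - LinearMap.adjoint (Qk i.1.1 i.1.2.1 i.1.2.2 i.2.2.le (c₀ L) (cB L) U₀) (((a L i : ℂ)) • toL2B i.1.1 i.1.2.1 (cB L) Y)) b‖ ≤ c137 L * ‖Y‖)
    (hOp139 : ∀ (L : ℕ), 1 < L → ∀ (i : Idx L) (U₀ : GaugeField (i.1.1.P i.1.2.2) 0 (Matrix.specialUnitaryGroup (Fin 2) ℂ)), RegPr i.1.1 i.1.2.1 i.1.2.2 (α L) U₀ →
      ∀ (X : PBond (i.1.1.P i.1.2.2) 0 → Matrix (Fin 2) (Fin 2) ℂ) (s : ℝ), RS i.1.1 i.1.2.1 i.1.2.2 i.2.2.le (c₀ L) (cB L) U₀ (DstarL2 i.1.1 i.1.2.1 i.1.2.2 (c₀ L) U₀ (toL2 i.1.1 i.1.2.2 (c₀ L) X)) = 0 → (∀ bd, ‖X bd‖ ≤ s) →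
        ∀ bd : PBond (i.1.1.P i.1.2.2) 0, ‖(toL2 i.1.1 i.1.2.2 (c₀ L)).symm (LinearMap.adjoint
            (DL2 i.1.1 i.1.2.1 i.1.2.2 (c₀ L) U₀ ∘ₗ GprimeT i.1.1 i.1.2.1 i.1.2.2 i.2.2.le (c₀ L) (cB L) (a L i) U₀ ∘ₗ RS i.1.1 i.1.2.1 i.1.2.2 i.2.2.le (c₀ L) (cB L) U₀ ∘ₗ DstarL2 i.1.1 i.1.2.1 i.1.2.2 (c₀ L) U₀)
            (DeltaEta i.1.1 i.1.2.1 i.1.2.2 (c₀ L) U₀ (toL2 i.1.1 i.1.2.2 (c₀ L) X))) bd‖ ≤ k139 L * s)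
    (hOp349 : ∀ (L : ℕ), 1 < L → ∀ (i : Idx L) (U₀ : GaugeField (i.1.1.P i.1.2.2) 0 (Matrix.specialUnitaryGroup (Fin 2) ℂ)), RegPr i.1.1 i.1.2.1 i.1.2.2 (α L) U₀ →
      ∀ (X : PBond (i.1.1.P i.1.2.2) 0 → Matrix (Fin 2) (Fin 2) ℂ) (s : ℝ), (∀ bd, ‖X bd‖ ≤ s) → ∀ bd : PBond (i.1.1.P i.1.2.2) 0,
        ‖(toL2 i.1.1 i.1.2.2 (c₀ L)).symm (DL2 i.1.1 i.1.2.1 i.1.2.2 (c₀ L) U₀ (DstarL2 i.1.1 i.1.2.1 i.1.2.2 (c₀ L) U₀ (toL2 i.1.1 i.1.2.2 (c₀ L) X) - RS i.1.1 i.1.2.1 i.1.2.2 i.2.2.le (c₀ L) (cB L) U₀ (DstarL2 i.1.1 i.1.2.1 i.1.2.2 (c₀ L) U₀ (toL2 i.1.1 i.1.2.2 (c₀ L) X)))) bd‖ ≤ k349 L * s) :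
    ∀ (L : ℕ), 1 < L → ∀ (i : Idx L) (U₀ : GaugeField (i.1.1.P i.1.2.2) 0 (Matrix.specialUnitaryGroup (Fin 2) ℂ)), RegPr i.1.1 i.1.2.1 i.1.2.2 (α L) U₀ →
      ∀ (Y : PBond (i.1.1.P i.1.2.1) 0 → Matrix (Fin 2) (Fin 2) ℂ),
        (∀ (μ : Fin (i.1.1.P i.1.2.2).d) (x : Site (i.1.1.P i.1.2.2) 0), ‖covCodiffCurlT 1 (bgUnits i.1.1 i.1.2.2 U₀) (H46 i.1.1 i.1.2.1 i.1.2.2 i.2.2.le (c₀ L) (cB L) (a L i) U₀ Y) μ x‖ ≤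
          (c137 L + k139 L * B₀ L + k349 L * B₀ L + (28 + 4) * α L * B₀ L) * eta i.1.1 i.1.2.1 i.1.2.2 ^ 3 * ‖Y‖) ∧
        (∀ (ν : Fin (i.1.1.P i.1.2.2).d) (x : Site (i.1.1.P i.1.2.2) 0), ‖covLapFormT 1 (bgUnits i.1.1 i.1.2.2 U₀) (H46 i.1.1 i.1.2.1 i.1.2.2 i.2.2.le (c₀ L) (cB L) (a L i) U₀ Y) ν x‖ ≤
          (c137 L + k139 L * B₀ L + k349 L * B₀ L + (28 + 4) * α L * B₀ L) * eta i.1.1 i.1.2.1 i.1.2.2 ^ 3 * ‖Y‖) := by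
  intro L hL i U₀ hU Y
  obtain ⟨hp, hq⟩ := hN06 L hL i U₀ hU
  -- (46)₀ for `H46` at this member, read pointwise
  have h46 := (h46tw_letter_of_N06_normH (c₀ := c₀) (cB := cB) (a := a) (ef := ef) (B₀ := B₀) hα hef hWe hWε hN06 norm_H₁ L hL i U₀ hU).2.2.1
  have h46' : ∀ (Y : PBond (i.1.1.P i.1.2.1) 0 → Matrix (Fin 2) (Fin 2) ℂ) (b : PBond (i.1.1.P i.1.2.2) 0),
      ‖H46 i.1.1 i.1.2.1 i.1.2.2 i.2.2.le (c₀ L) (cB L) (a L i) U₀ Y b‖ ≤ B₀ L * eta i.1.1 i.1.2.1 i.1.2.2 * ‖Y‖ := fun Y b => (norm_le_pi_norm _ b).trans (h46 Y)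
  have key := hΔH_of_opRows (h := i.2.2.le) hU hp hq (hα L hL).le (hB₀ L hL).le h46' (h137 L hL i U₀ hU) (hOp139 L hL i U₀ hU) (hOp349 L hL i U₀ hU)
  exact ⟨fun μ x => key.1 Y μ x, fun ν x => key.2 Y ν x⟩

end Summit.QuantumFields.YangMills.Theorems.Prop7H46TwoOfOpRowsFamily

end
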